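import Literature.AlgebraicGeometry.Resolution.AlterationsStrong
import Literature.AlgebraicGeometry.Resolution.Blowups
import Literature.AlgebraicGeometry.Motives.VarietiesProperProofs
import HarnessLib

/-!
# De Jong's alteration theorem: the induction step split at 4.10 (de Jong 1996, 4.6–4.28)

Topic: `Literature/AlgebraicGeometry/Resolution`. Companion to `AlterationsStrong.lean`, which
vendors the induction step of the printed proof of de Jong 1996, Thm. 4.1 over an algebraically
closed field as ONE named fact `DeJong1996InductionStep` (4.6–4.28) and proves the assembly of
Thm. 4.1 from it. This file is the first layer of its decomposition along the printed text. The
proof (p. 66: "4.4. Strategy of proof. — We proceed step by step, each time reducing the theorem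
to a case where we have additional restraints, numbered (i), (ii), etc., on the pair `(X, Z)`")
first reaches, by elementary means, the standing hypotheses

* (i) `k` is algebraically closed (4.5), (iii) `X` is projective (4.6 Chow's lemma, 4.7 projective
  closure), (iv) "There exists a divisor `D ⊂ X` such that `Z` is the support of `D`" (4.8, blowing
  up `Z`; divisor = effective Cartier divisor, 2.3), (v) `X` is a normal variety (4.10,
  normalisation; "(iii) holds as long as we only take projective alterations"),

each time replacing `(X, Z)` by a pair of the same dimension along a generically étale alteration
(4.4), and then runs the deep part 4.11–4.28 (Lefschetz pencil, Stein factorisation, multisections,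
moduli of stable pointed curves, flattening and the three-point lemma, the induction hypothesis for
the base `(Y, D)` with `dim Y = dim X - 1` in 4.22, semi-stable resolution §3 and 4.23–4.28) under
(i), (iii)–(v). Accordingly:

* `DeJong1996.NormalProjectivePair f Z` — the pair `(X → Spec k, Z)` satisfies (iii), (iv), (v):
  `X` is an integral normal scheme, projective over `k`, and `Z` is the support of an effective
  Cartier divisor (`IsEffectiveCartier`, `Blowups.lean`). Proved API: such an `X → Spec k` is
  proper (hence separated, of finite type, quasi-compact), `Z` is closed and `Z ≠ X`.
* `DeJong1996NormalProjectiveReduction` — NAMED FACT, de Jong 1996, 4.6–4.10: over an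
  algebraically closed field, Thm. 4.1 (with its generically-étale clause) for the pair `(X, Z)`
  follows from Thm. 4.1 for all normal projective pairs of the same dimension.
* `DeJong1996NormalProjectiveStep` — NAMED FACT, de Jong 1996, 4.11–4.28: over an algebraically
  closed field, Thm. 4.1 in dimension `≤ d` (`DeJong1996.StatementUpToDim k d`, consumed in 4.22)
  implies Thm. 4.1 for normal projective pairs of dimension `d + 1`.
* `DeJong1996InductionStep.of_reduction_of_step` — PROVED: the two facts give
  `DeJong1996InductionStep` (pairs of dimension `≤ d` are served by the induction hypothesis
  directly, normal projective pairs of dimension `d + 1` by the step, all others by the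
  reduction), and hence, with `DeJong1996Descent` (4.5), `DeJong1996Strong`,
  `DeJong1996StrongPerfect` and `DeJong1996Projective` (`AlterationsStrong.lean`).

Both named facts are nodes to be decomposed further (4.6/4.7 from `ChowLemmaIntegral_holds`; 4.8
from blow-ups `IsBlowup`, `Stacks02ND`, `Stacks02NS` and projectivity of blow-ups; 4.10 from
`NoetherFiniteIntegralClosure_holds`; 4.11–4.22 and 4.23–4.28 once semi-stable curves over a base
are in the library); the owning literature unit's `NOTES.md` keeps the DAG.

## Sources

* A. J. de Jong, *Smoothness, semi-stability and alterations*, Publ. Math. IHÉS 83 (1996) 51–93: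
  2.3 (divisor), 2.20 (alteration), Thm. 4.1 (p. 66), 4.3–4.10 (pp. 66–67), 4.11–4.28 (pp. 67–76).
* The Stacks Project, Tag 033H (normal schemes: all local rings are normal domains).
-/

noncomputable section

open CategoryTheory AlgebraicGeometry TopologicalSpace Topology

namespace Literature.AlgebraicGeometry.Resolution

universe u

/-! ## The standing hypotheses (iii), (iv), (v) of de Jong 1996, 4.10 -/

namespace DeJong1996

/-- **The pair `(X, Z)` after the preliminary reductions of de Jong 1996, 4.6–4.10**: `X → Spec k`
satisfies "(iii) `X` is projective" (a projective variety over `k`: `X` integral with a closed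
`k`-immersion into some `ℙⁿ_k`, `Literature.AlgebraicGeometry.Motives.IsProjectiveOver`), "(iv)
There exists a divisor `D ⊂ X` such that `Z` is the support of `D`" (2.3: a divisor is "a closed
subscheme `D ⊂ X` regularly embedded of codimension 1, i.e. a positive divisor", i.e. an effective
Cartier divisor: an ideal sheaf locally generated by one regular element, `IsEffectiveCartier`;
`Z` is its support) and "(v) `X` is a normal variety" (all local rings integrally closed in their
fraction fields, Stacks 033H). [cite: DeJong1996, 4.7–4.10, p. 67] -/
structure NormalProjectivePair {k : Type u} [Field k] {X : Scheme.{u}} (f : X ⟶ Spec (.of k))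
    (Z : Set X) : Prop where
  /-- `X` is integral (a variety, 2.9) -/
  isIntegral : IsIntegral X
  /-- (iii) `X` is projective over `k` -/
  isProjectiveOver : Literature.AlgebraicGeometry.Motives.IsProjectiveOver (Over.mk f)
  /-- (iv) `Z` is the support of an effective Cartier divisor of `X` -/
  exists_isEffectiveCartier :
    ∃ I : X.IdealSheafData, IsEffectiveCartier I ∧ (I.support : Set X) = Z
  /-- (v) `X` is normal -/
  isIntegrallyClosed : ∀ x : X, IsIntegrallyClosed (X.presheaf.stalk x)

namespace NormalProjectivePair

variable {k : Type u} [Field k] {X : Scheme.{u}} {f : X ⟶ Spec (.of k)} {Z : Set X}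

/-- A projective `k`-scheme is proper over `k`. [folklore] -/
theorem isProper (h : NormalProjectivePair f Z) : IsProper f :=
  Literature.AlgebraicGeometry.Motives.IsProjectiveOver.isProper (X := Over.mk f) h.isProjectiveOver

/-- A projective `k`-scheme is separated over `k`. [folklore] -/
theorem isSeparated (h : NormalProjectivePair f Z) : IsSeparated f :=
  haveI := h.isProper
  inferInstance

/-- A projective `k`-scheme is locally of finite type over `k`. [folklore] -/
theorem locallyOfFiniteType (h : NormalProjectivePair f Z) : LocallyOfFiniteType f :=
  haveI := h.isProper
  inferInstance

/-- A projective `k`-scheme is quasi-compact over `k`. [folklore] -/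
theorem quasiCompact (h : NormalProjectivePair f Z) : QuasiCompact f :=
  haveI := h.isProper
  inferInstance

/-- The support of a divisor is closed. [folklore] -/
theorem isClosed (h : NormalProjectivePair f Z) : IsClosed Z := by
  obtain ⟨I, -, hI⟩ := h.exists_isEffectiveCartier
  rw [← hI]
  exact I.support.isClosed

/-- The support of an effective Cartier divisor on an integral scheme misses the generic point:
a local equation is a regular element, hence non-zero, hence invertible at the generic point.
[folklore] -/
theorem genericPoint_notMem_support [IsIntegral X] {I : X.IdealSheafData}
    (hI : IsEffectiveCartier I) : genericPoint X ∉ (I.support : Set X) := by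
  obtain ⟨U, hηU, g, hg, hIU⟩ := hI (genericPoint X)
  intro hη
  rw [SetLike.mem_coe, Scheme.IdealSheafData.mem_support_iff_of_mem (U := U) hηU,
    Scheme.mem_zeroLocus_iff] at hη
  have hgI : g ∈ I.ideal U := by rw [hIU]; exact Ideal.mem_span_singleton_self g
  apply hη g hgI
  -- `g ≠ 0`, so the basic open `D(g)` is non-empty and contains the generic point
  haveI : Nonempty (U : X.Opens) := ⟨⟨_, hηU⟩⟩
  have hg0 : g ≠ 0 := nonZeroDivisors.ne_zero hg
  have hne : (X.basicOpen g : Set X).Nonempty := by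
    rw [Set.nonempty_iff_ne_empty]
    intro he
    apply hg0
    have hbot : X.basicOpen g = ⊥ := TopologicalSpace.Opens.ext (by simpa using he)
    rwa [AlgebraicGeometry.basicOpen_eq_bot_iff] at hbot
  exact ((genericPoint_spec X).mem_open_set_iff (X.basicOpen g).isOpen).mpr (by simpa using hne)

/-- The support of a divisor on a variety is a proper subset. [folklore] -/
theorem ne_univ (h : NormalProjectivePair f Z) : Z ≠ Set.univ := by
  haveI := h.isIntegral
  obtain ⟨I, hI, hIZ⟩ := h.exists_isEffectiveCartier
  intro hZ
  have := genericPoint_notMem_support hI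
  rw [hIZ, hZ] at this
  exact this (Set.mem_univ _)

/-- Thm. 4.1 in dimension `≤ d` serves every normal projective pair of dimension `≤ d`.
[folklore] -/
theorem conclusionGenericallyEtale_of_statementUpToDim (h : NormalProjectivePair f Z) {d : ℕ}
    (hd : StatementUpToDim k d) (hdim : topologicalKrullDim X ≤ d) :
    ConclusionGenericallyEtale f Z :=
  hd X f Z h.isSeparated h.locallyOfFiniteType h.quasiCompact h.isIntegral hdim h.isClosed
    h.ne_univ

end NormalProjectivePair

end DeJong1996

/-! ## 4.6–4.10 and 4.11–4.28 as named facts -/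

/-- NAMED FACT — **de Jong 1996, 4.6–4.10: reduction to normal projective pairs.** Over an
algebraically closed field `k` (4.5 (i)), for a variety `X` and a proper closed subset `Z ⊂ X`:
"4.6. We apply Chow's lemma to the variety `X`. This gives a modification `φ : X' → X` such that
`X'` is quasi-projective over `k`. Put `Z' = φ⁻¹(Z)`. As remarked in 4.4 […] we reduce to the case
where we have (i) and (ii) `X` is quasi-projective. 4.7. […] Let `j : X → X̄` be an open immersion
of `X` into a projective variety […] We have reduced the problem to the case where we have (i) and
(iii) `X` is projective. 4.8. […] Let `φ : X' → X` be the blowing up in the ideal sheaf of `Z`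
[…] we reduce to the case where we have (i), (iii) and (iv) There exists a divisor `D ⊂ X` such
that `Z` is the support of `D`. […] 4.10. […] taking `φ` equal to the normalization morphism we
may assume in addition to (i)–(iv) that we have (v) `X` is a normal variety." Each replacement is
along a generically étale alteration (4.4, `DeJong1996.ConclusionGenericallyEtale.of_isAlteration`)
or an open immersion into a projective closure (4.7), so it preserves the dimension
(`IsAlteration.topologicalKrullDim_eq`, `topologicalKrullDim_eq_of_isOpenImmersion`). Vendored as
that sufficiency: Thm. 4.1 with its generically-étale clause for all normal projective pairs
(`DeJong1996.NormalProjectivePair`) over `k` of the same dimension as `X` implies it for `(X, Z)`.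
Users take `(h : DeJong1996NormalProjectiveReduction)`. [cite: DeJong1996, 4.6–4.10, pp. 66–67] -/
def DeJong1996NormalProjectiveReduction : Prop :=
  ∀ (k : Type u) [Field k] [IsAlgClosed k] (X : Scheme.{u}) (f : X ⟶ Spec (.of k)) (Z : Set X),
    IsSeparated f → LocallyOfFiniteType f → QuasiCompact f → IsIntegral X → IsClosed Z →
      Z ≠ Set.univ →
        (∀ (X' : Scheme.{u}) (f' : X' ⟶ Spec (.of k)) (Z' : Set X'),
          DeJong1996.NormalProjectivePair f' Z' → topologicalKrullDim X' = topologicalKrullDim X →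
            DeJong1996.ConclusionGenericallyEtale f' Z') →
          DeJong1996.ConclusionGenericallyEtale f Z

/-- NAMED FACT — **de Jong 1996, 4.11–4.28: the induction step for normal projective pairs.**
Over an algebraically closed field `k`, assume Thm. 4.1 with its generically-étale clause for all
pairs `(Y, D)` over `k` with `dim Y ≤ d` (`DeJong1996.StatementUpToDim k d`; consumed in 4.22:
"At this point we apply the induction hypothesis: there exists a nonsingular projective variety
`Y'` and a generically étale alteration `ψ : Y' → Y` such that the closed subset `ψ⁻¹(D)` is a
strict normal crossings divisor", `dim Y = dim X - 1`). Then Thm. 4.1 with the clause holds for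
every pair `(X, Z)` over `k` satisfying (iii) `X` projective, (iv) `Z` the support of a divisor,
(v) `X` normal (`DeJong1996.NormalProjectivePair`) with `dim X = d + 1`. This is the content of
Lemma 4.11 (Lefschetz pencil: blowing up a finite set of regular points, `f : X' → ℙ^{d-1}` with
one-dimensional fibres), 4.12 (Stein factorisation, (vi) a)–d)), Lemma 4.13–4.14 (a multisection
with three smooth points on every fibre component, (vi) e)), 4.15–4.16 (generically étale
projective alterations of the base; Galois normalisation, (vi) f): `Z` a union of sections), 4.17
(the projective level-`ℓ` moduli scheme of stable `n`-pointed curves, 2.24, (vi) g)), 4.18–4.21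
(flattening 2.19 and the three-point Lemma 4.20: the rational map `β : 𝒞 ⇢ X` extends after a
modification of the base), 4.22 (the induction hypothesis for `(Y, D)`), 4.23–4.28 with Lemma 3.2
and 3.5 (explicit resolution of a split semi-stable curve over a regular base degenerating over a
strict normal crossings divisor, and strictification of the boundary, 2.4). Users take
`(h : DeJong1996NormalProjectiveStep)`; it is the node to decompose further.
[cite: DeJong1996, 4.11–4.28, pp. 67–76] -/
def DeJong1996NormalProjectiveStep : Prop :=
  ∀ (k : Type u) [Field k] [IsAlgClosed k] (d : ℕ), DeJong1996.StatementUpToDim k d →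
    ∀ (X : Scheme.{u}) (f : X ⟶ Spec (.of k)) (Z : Set X), DeJong1996.NormalProjectivePair f Z →
      topologicalKrullDim X = (d + 1 : ℕ) → DeJong1996.ConclusionGenericallyEtale f Z

/-! ## The assembly -/

/-- Dimension bookkeeping in `WithBot ℕ∞`: a dimension `≤ d + 1` which is not `≤ d` is `d + 1`.
[folklore] -/
theorem WithBot.ENat.eq_succ_of_le_succ_of_not_le {x : WithBot ℕ∞} {d : ℕ}
    (h₁ : x ≤ (d + 1 : ℕ)) (h₂ : ¬x ≤ d) : x = (d + 1 : ℕ) := by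
  have e : ∀ a : ℕ, ((a : ℕ∞) : WithBot ℕ∞) = (a : WithBot ℕ∞) := fun a => rfl
  rw [← e] at h₁ h₂ ⊢
  induction x using WithBot.recBotCoe with
  | bot => exact absurd bot_le h₂
  | coe n =>
    rw [WithBot.coe_le_coe] at h₁ h₂
    rw [WithBot.coe_inj]
    induction n using ENat.recTopCoe with
    | top => exact absurd (top_le_iff.mp h₁) (ENat.coe_ne_top _)
    | coe m =>
      rw [ENat.coe_le_coe] at h₁ h₂
      rw [ENat.coe_inj]
      omega

/-- **The induction step of de Jong 1996, Thm. 4.1 from its two printed halves**: the preliminary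
reductions 4.6–4.10 (`DeJong1996NormalProjectiveReduction`) and the step for normal projective
pairs 4.11–4.28 (`DeJong1996NormalProjectiveStep`) give `DeJong1996InductionStep`. Given Thm. 4.1
in dimension `≤ d` and a pair `(X, Z)` with `dim X ≤ d + 1`, reduce to normal projective pairs
`(X', Z')` with `dim X' = dim X`; those with `dim X' ≤ d` are served by the induction hypothesis,
the others have `dim X' = d + 1` and are served by the step. [cite: DeJong1996, 4.3–4.10, pp. 66–67] -/
theorem DeJong1996InductionStep.of_reduction_of_step (hred : DeJong1996NormalProjectiveReduction.{u})
    (hstep : DeJong1996NormalProjectiveStep.{u}) : DeJong1996InductionStep.{u} := by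
  intro k _ _ d ih X f Z hs hl hq hi hdim hZ hZ'
  refine hred k X f Z hs hl hq hi hZ hZ' fun X' f' Z' hP hdimX' => ?_
  by_cases hle : topologicalKrullDim X' ≤ d
  · exact hP.conclusionGenericallyEtale_of_statementUpToDim ih hle
  · exact hstep k d ih X' f' Z' hP
      (WithBot.ENat.eq_succ_of_le_succ_of_not_le (hdimX'.trans_le hdim) hle)

/-- Over an algebraically closed field: the base case 4.3, the reductions 4.6–4.10 and the step
4.11–4.28 give Thm. 4.1 with its generically-étale clause in every dimension.
[cite: DeJong1996, 4.3–4.28, pp. 66–76] -/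
theorem DeJong1996StrongAlgClosed.of_reduction_of_step (hred : DeJong1996NormalProjectiveReduction.{u})
    (hstep : DeJong1996NormalProjectiveStep.{u}) : DeJong1996StrongAlgClosed.{u} :=
  DeJong1996StrongAlgClosed.of_inductionStep (DeJong1996InductionStep.of_reduction_of_step hred hstep)

/-- **Assembly of the printed proof of Thm. 4.1 from three vendored blocks**: 4.5 (reduction to an
algebraically closed field, `DeJong1996Descent`), 4.6–4.10 and 4.11–4.28.
[cite: DeJong1996, 4.3–4.28, pp. 66–76] -/
theorem DeJong1996Strong.of_descent_of_reduction_of_step (h45 : DeJong1996Descent.{u})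
    (hred : DeJong1996NormalProjectiveReduction.{u}) (hstep : DeJong1996NormalProjectiveStep.{u}) :
    DeJong1996Strong.{u} :=
  DeJong1996Strong.of_descent_of_inductionStep h45
    (DeJong1996InductionStep.of_reduction_of_step hred hstep)

/-- The same assembly gives the last sentence of Thm. 4.1 (perfect ground fields).
[cite: DeJong1996, 4.3–4.28, pp. 66–76] -/
theorem DeJong1996StrongPerfect.of_descent_of_reduction_of_step (h45 : DeJong1996Descent.{u})
    (hred : DeJong1996NormalProjectiveReduction.{u}) (hstep : DeJong1996NormalProjectiveStep.{u}) :
    DeJong1996StrongPerfect.{u} :=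
  DeJong1996StrongPerfect.of_descent_of_inductionStep h45
    (DeJong1996InductionStep.of_reduction_of_step hred hstep)

/-- `DeJong1996Projective` (Thm. 4.1 (i)) from the three vendored blocks.
[cite: DeJong1996, Thm. 4.1, p. 66] -/
theorem DeJong1996Projective.of_descent_of_reduction_of_step (h45 : DeJong1996Descent.{u})
    (hred : DeJong1996NormalProjectiveReduction.{u}) (hstep : DeJong1996NormalProjectiveStep.{u}) :
    DeJong1996Projective.{u} :=
  (DeJong1996Strong.of_descent_of_reduction_of_step h45 hred hstep).projective

end Literature.AlgebraicGeometry.Resolution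

end
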